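import Literature.NumberTheory.EllipticCurves.OggFormulaJ1728TwoProofs
import Literature.NumberTheory.DiophantineGeometry.ConductorRingOfIntegersProofs
import Literature.NumberTheory.EllipticCurves.LocalEulerFactorModel
import HarnessLib

/-!
# Rank-2 observatory (b2b-bsdr2, cert-2 gen 6): kernel-checkable TATE CERTIFICATES (Steps 1–5) —
# the conductor exponent at an ADDITIVE place of type `II`, `III`, `IV` with NO named fact

HONEST FRAMING: per-curve certified theorems and census instruments; no claim on BSD in rank ≥ 2.

The conductor certificates of gens 5–6 reach the rows of the rank-3 census that are TAME at `2`
(semistable at `2`); for the 3 024 rows additive at `2` the conductor hypothesis `hN` survived,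
because `f₂` needs Tate's algorithm (or Rizzo's Table III).  The tree PROVES forward evaluations of
Tate's algorithm over a complete DVR (`TateAlgorithmEvalProofs`: `kodairaSymbolOfMinimal_eq_II_of_step2`,
`…_III_of_step2`, `…_IV_of_step2`, …) and `conductorExponent` IS Ogg's formula
(`f_v = ord_v Δ_min + 1 - m_v`, `DiophantineGeometry/Conductor`).  This file turns Steps 1–5 into a
kernel-decidable certificate on an INTEGER model:

* `Step2Cert` = a prime `p`, an integer change of variables `(r, s, t)` (with `u = 1`) to a
  Step-2 normalised model `M` (`p ∣ a₃, a₄, a₆, b₂`: the singular point of the reduction at `(0,0)`),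
  `n = v_p(Δ)`, the exit step (`2 ↦ II`: `p ∥ a₆`; `3 ↦ III`: `p² ∣ a₆`, `pᵏ ∥ b₈`, `k < 3`;
  `4 ↦ IV`: `p² ∣ a₆`, `p³ ∣ b₈`, `pᵏ ∥ b₆`, `k < 3`) and `k`; `Step2Cert.check` decides all of it by
  integer divisibilities;
* `kodairaSymbolAt_and_ordMinimalDiscriminant_of_step2_exits` — the engine: a `ℚ`-model wrapper of
  the three local theorems at ANY finite place `v` of `𝓞 ℚ` (the `II`/`III` cases are exactly
  `WeierstrassCurve.kodairaSymbolAt_and_ordMinimalDiscriminant_of_step2_model` of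
  `OggFormulaJ1728TwoProofs`; the `IV` exit is added), minimality from `v(Δ) = n < 12`;
* **`Step2Cert.sound : c.check W₀ = true → natGenerator v = c.p →
  kodairaSymbolAt v (W₀ ⊗ ℚ) = c.type ∧ ordMinimalDiscriminant v (W₀ ⊗ ℚ) = c.n`** and
  **`Step2Cert.conductorExponent_eq` / `…_int_eq : f_v (W₀ ⊗ ℚ) = c.n + 1 - m(c.type)`** at the
  places of `𝓞 ℚ` resp. `ℤ` (transfer `conductorExponent_eq_of_primesEquiv_eq`) — NO named fact;
* self-tests on rank-3 census curves (Cremona labels; engine 1 = own Tate Steps 1–5 in Python,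
  engine 2 = PARI `elllocalred`, job j101307, agree on all 872 rows of type II/III/IV at `2` and all
  540 at `3`): `f₂(26284a1) = 2` (type `IV`), `f₂(55064b1) = 3` (`III`), `f₂(269936a1) = 4` (`II`),
  `f₃(38601a1) = 2` (`III`) — hypothesis-free theorems.

Types `I₀*`, `Iₙ*`, `IV*`, `III*`, `II*` (Steps 6–10; 71 % of the rows additive at `2`) need the
deeper wrappers (`kodairaSymbolOfMinimal_eq_Istar_zero_of_step6`, `…_Istar_of_models`, …) and
minimality beyond `v(Δ) < 12` (gen-5 Kraus certificates): left to gen 7 (`GEN7-PLAN.md`).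

References: J. H. Silverman, *Advanced Topics in the Arithmetic of Elliptic Curves*, GTM 151
(1994), IV.9.4 (Tate's algorithm, Steps 1–5), IV.11.1 (Ogg's formula), Table 4.1 [Silverman1994];
J. H. Silverman, *The Arithmetic of Elliptic Curves*, 2nd ed. (2009), III.1 (change of variables),
VII.1 Remark 1.1 (minimality from `v(Δ) < 12`) [SilvermanAEC2009]; J. E. Cremona, *Algorithms for
Modular Elliptic Curves*, 2nd ed. (1997), §3.2 and Tables [CremonaAlgorithms1997].
-/

open scoped NumberField
open IsDedekindDomain Rat.HeightOneSpectrum WeierstrassCurve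
  Literature.NumberTheory.EllipticCurves Literature.NumberTheory.GaloisRepresentations
  Literature.NumberTheory.DiophantineGeometry Literature.NumberTheory.DiophantineGeometry.TateAlgorithm

namespace Summit.BirchSwinnertonDyer.BirchSwinnertonDyer.Rank2Observatory.Tate

/-! ### `p`-adic bookkeeping at a finite place of `𝓞 ℚ` -/

section Padic

variable (v : HeightOneSpectrum (𝓞 ℚ))

/-- `|n|_v ≤ exp(-e)` at the place above `p` when `pᵉ ∣ n`. [folklore] -/
theorem valuation_le_of_pow_dvd {p : ℕ} (hv : natGenerator v = p) {n : ℤ} {e : ℕ}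
    (h : (p : ℤ) ^ e ∣ n) : v.valuation ℚ (n : ℚ) ≤ WithZero.exp (-(e : ℤ)) :=
  Rat.valuation_intCast_le v (by rw [hv]; exact h)

/-- `|n|_v = exp(-e)` at the place above `p` when `pᵉ ∥ n`. [folklore] -/
theorem valuation_eq_of_pow_dvd_of_not {p : ℕ} (hv : natGenerator v = p) {n : ℤ} {e : ℕ}
    (h : (p : ℤ) ^ e ∣ n) (h' : ¬ (p : ℤ) ^ (e + 1) ∣ n) :
    v.valuation ℚ (n : ℚ) = WithZero.exp (-(e : ℤ)) := by
  obtain ⟨m, rfl⟩ := h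
  have hm : ¬ (p : ℤ) ∣ m := fun ⟨d, hd⟩ ↦ h' ⟨d, by rw [hd, pow_succ]; ring⟩
  have hp : v.valuation ℚ (p : ℚ) = WithZero.exp (-1 : ℤ) := by
    have := Rat.valuation_natGenerator v; rwa [hv] at this
  push_cast
  rw [map_mul, map_pow, hp, Rat.valuation_intCast_eq_one v (by rw [hv]; exact hm), mul_one,
    ← WithZero.exp_nsmul]
  simp

/-- An element of `O_v` of valuation exactly `exp(-n)` is not divisible by `ϖⁿ⁺¹`. [folklore] -/
theorem not_pow_succ_dvd_of_valued_eq {x : v.adicCompletionIntegers ℚ} {n : ℕ}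
    (h : Valued.v (x : v.adicCompletion ℚ) = WithZero.exp (-(n : ℤ))) :
    ¬ uniformizer (v.adicCompletionIntegers ℚ) ^ (n + 1) ∣ x := by
  have hϖ : Irreducible (uniformizer (v.adicCompletionIntegers ℚ)) := irreducible_uniformizer
  obtain ⟨u, hu, hx⟩ := exists_isUnit_eq_uniformizer_pow_mul_of_valued_eq v h
  rintro ⟨c, hc⟩
  rw [hx, pow_succ, mul_assoc] at hc
  have hc' : u = uniformizer (v.adicCompletionIntegers ℚ) * c :=
    mul_left_cancel₀ (pow_ne_zero n hϖ.ne_zero) hc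
  exact hϖ.not_isUnit (isUnit_of_mul_isUnit_left (hc' ▸ hu))

end Padic

/-! ### The engine: types `II`, `III`, `IV` read on a Step-2 normalised `ℚ`-model -/

section Engine

variable (v : HeightOneSpectrum (𝓞 ℚ)) (W : WeierstrassCurve ℚ)

/-- **Types `II` / `III` / `IV` read on a Step-2 normalised `ℚ`-model at a finite place `v`.**
Let `M = D • W` be a `ℚ`-model of the elliptic curve `W` with `v`-integral coefficients,
`ord_v Δ(M) = n ∈ [1, 12)` (so `M` is minimal at `v`, *AEC* VII.1.1) and `ϖ ∣ a₃, a₄, a₆, b₂`.  If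
`ord_v a₆ = 1` the type is `II`; if `ϖ² ∣ a₆` and `ord_v b₈ = k < 3`, type `III`; if `ϖ² ∣ a₆`,
`ϖ³ ∣ b₈` and `ord_v b₆ = k < 3`, type `IV`; always `ord_v Δ_min = n`.  (Cases `II`, `III`:
`WeierstrassCurve.kodairaSymbolAt_and_ordMinimalDiscriminant_of_step2_model`; the same proof with
`kodairaSymbolOfMinimal_eq_IV_of_step2` for `IV`.)
[cite: Silverman1994, IV.9.4 Steps 1–5] [cite: SilvermanAEC2009, VII.1 Remark 1.1] -/
theorem kodairaSymbolAt_and_ordMinimalDiscriminant_of_step2_exits [W.IsElliptic]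
    (M : WeierstrassCurve ℚ) (D : VariableChange ℚ) (hM : M = D • W)
    (h₁ : v.valuation ℚ M.a₁ ≤ 1) (h₂ : v.valuation ℚ M.a₂ ≤ 1)
    (h₃ : v.valuation ℚ M.a₃ ≤ WithZero.exp (-1 : ℤ))
    (h₄ : v.valuation ℚ M.a₄ ≤ WithZero.exp (-1 : ℤ))
    (h₆ : v.valuation ℚ M.a₆ ≤ WithZero.exp (-1 : ℤ))
    (hb₂ : v.valuation ℚ M.b₂ ≤ WithZero.exp (-1 : ℤ))
    {n : ℕ} (hn1 : 1 ≤ n) (hn : n < 12) (hΔ : v.valuation ℚ M.Δ = WithZero.exp (-(n : ℤ)))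
    {T : KodairaSymbol}
    (hexit : (v.valuation ℚ M.a₆ = WithZero.exp (-((1 : ℕ) : ℤ)) ∧ T = .II) ∨
      (v.valuation ℚ M.a₆ ≤ WithZero.exp (-2 : ℤ) ∧
        (∃ k : ℕ, k < 3 ∧ v.valuation ℚ M.b₈ = WithZero.exp (-(k : ℤ))) ∧ T = .III) ∨
      (v.valuation ℚ M.a₆ ≤ WithZero.exp (-2 : ℤ) ∧ v.valuation ℚ M.b₈ ≤ WithZero.exp (-3 : ℤ) ∧
        (∃ k : ℕ, k < 3 ∧ v.valuation ℚ M.b₆ = WithZero.exp (-(k : ℤ))) ∧ T = .IV)) :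
    W.kodairaSymbolAt v = T ∧ W.ordMinimalDiscriminant v = n := by
  rcases hexit with hII | hIII | ⟨ha₆, hb₈, ⟨k, hk, hb₆⟩, rfl⟩
  · exact W.kodairaSymbolAt_and_ordMinimalDiscriminant_of_step2_model v M D hM h₁ h₂ h₃ h₄ h₆ hb₂
      hn1 hn hΔ (Or.inl hII)
  · exact W.kodairaSymbolAt_and_ordMinimalDiscriminant_of_step2_model v M D hM h₁ h₂ h₃ h₄ h₆ hb₂
      hn1 hn hΔ (Or.inr hIII)
  -- exit at Step 5: type `IV` (the proof follows the `II`/`III` wrapper line by line)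
  haveI := perfectField_residueField_adicCompletionIntegers (K := ℚ) v
  haveI hMell : M.IsElliptic := by rw [hM]; infer_instance
  have hexp1 : WithZero.exp (-1 : ℤ) ≤ (1 : WithZero (Multiplicative ℤ)) := by
    rw [← WithZero.exp_zero, WithZero.exp_le_exp]; omega
  have hint : M.IsIntegralAt v :=
    M.isIntegralAt_of_valuation_le_one v h₁ h₂ (h₃.trans hexp1) (h₄.trans hexp1) (h₆.trans hexp1)
  have hmin : M.IsMinimalAt v :=
    isMinimalAt_of_lt_valuation_Δ_holds hint (by rw [hΔ]; exact WithZero.exp_lt_exp.mpr (by omega))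
  set X := M.baseChange (v.adicCompletion ℚ) with hX
  haveI hXint : X.IsIntegral (v.adicCompletionIntegers ℚ) := hint
  haveI hXmin : X.IsMinimal (v.adicCompletionIntegers ℚ) := hmin
  haveI hXell : X.IsElliptic := by rw [hX, WeierstrassCurve.baseChange]; infer_instance
  set I := X.integralModel (v.adicCompletionIntegers ℚ) with hI
  have hva : ∀ (x : v.adicCompletionIntegers ℚ) (q : ℚ),
      algebraMap (v.adicCompletionIntegers ℚ) (v.adicCompletion ℚ) x =
        algebraMap ℚ (v.adicCompletion ℚ) q →
      Valued.v (x : v.adicCompletion ℚ) = v.valuation ℚ q := by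
    intro x q h
    rw [show (x : v.adicCompletion ℚ) = algebraMap _ (v.adicCompletion ℚ) x from rfl, h,
      WeierstrassCurve.valued_algebraMap_adicCompletion]
  have hIa₃ : Valued.v ((I.a₃ : v.adicCompletionIntegers ℚ) : v.adicCompletion ℚ) =
      v.valuation ℚ M.a₃ :=
    hva _ _ (by rw [hI, integralModel_a₃_eq, hX, WeierstrassCurve.baseChange, map_a₃])
  have hIa₄ : Valued.v ((I.a₄ : v.adicCompletionIntegers ℚ) : v.adicCompletion ℚ) =
      v.valuation ℚ M.a₄ :=
    hva _ _ (by rw [hI, integralModel_a₄_eq, hX, WeierstrassCurve.baseChange, map_a₄])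
  have hIa₆ : Valued.v ((I.a₆ : v.adicCompletionIntegers ℚ) : v.adicCompletion ℚ) =
      v.valuation ℚ M.a₆ :=
    hva _ _ (by rw [hI, integralModel_a₆_eq, hX, WeierstrassCurve.baseChange, map_a₆])
  have hIb₂ : Valued.v ((I.b₂ : v.adicCompletionIntegers ℚ) : v.adicCompletion ℚ) =
      v.valuation ℚ M.b₂ :=
    hva _ _ (by rw [hI, integralModel_b₂_eq, hX, WeierstrassCurve.baseChange, map_b₂])
  have hIb₆ : Valued.v ((I.b₆ : v.adicCompletionIntegers ℚ) : v.adicCompletion ℚ) =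
      v.valuation ℚ M.b₆ :=
    hva _ _ (by rw [hI, integralModel_b₆_eq, hX, WeierstrassCurve.baseChange, map_b₆])
  have hIb₈ : Valued.v ((I.b₈ : v.adicCompletionIntegers ℚ) : v.adicCompletion ℚ) =
      v.valuation ℚ M.b₈ :=
    hva _ _ (by rw [hI, integralModel_b₈_eq, hX, WeierstrassCurve.baseChange, map_b₈])
  have hIΔ : Valued.v ((I.Δ : v.adicCompletionIntegers ℚ) : v.adicCompletion ℚ) =
      WithZero.exp (-(n : ℤ)) := by
    rw [← hΔ]
    exact hva _ _ (by rw [hI, integralModel_Δ_eq, hX, WeierstrassCurve.baseChange, map_Δ])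
  set ϖ := uniformizer (v.adicCompletionIntegers ℚ)
  have dvdn : ∀ {x : v.adicCompletionIntegers ℚ} (m : ℕ),
      Valued.v (x : v.adicCompletion ℚ) ≤ WithZero.exp (-(m : ℤ)) → ϖ ^ m ∣ x := fun {x} m hx ↦
    uniformizer_pow_dvd_of_valued_le v (x := x) (n := m) hx
  have dvd1 : ∀ {x : v.adicCompletionIntegers ℚ},
      Valued.v (x : v.adicCompletion ℚ) ≤ WithZero.exp (-1 : ℤ) → ϖ ∣ x := fun {x} hx ↦ by
    have := dvdn (x := x) 1 (by exact_mod_cast hx)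
    rwa [pow_one] at this
  have nΔ : ϖ ∣ I.Δ := dvd1 (by rw [hIΔ, WithZero.exp_le_exp]; omega)
  have n3 : ϖ ∣ I.a₃ := dvd1 (by rw [hIa₃]; exact h₃)
  have n4 : ϖ ∣ I.a₄ := dvd1 (by rw [hIa₄]; exact h₄)
  have n6 : ϖ ∣ I.a₆ := dvd1 (by rw [hIa₆]; exact h₆)
  have nb₂ : ϖ ∣ I.b₂ := dvd1 (by rw [hIb₂]; exact hb₂)
  have hordΔ : (IsDiscreteValuationRing.addVal (v.adicCompletionIntegers ℚ) I.Δ).toNat = n :=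
    addVal_toNat_eq_of_valued_eq v hIΔ
  have hK : I.kodairaSymbolOfMinimal = .IV := by
    refine kodairaSymbolOfMinimal_eq_IV_of_step2 nΔ n3 n4 n6 nb₂ ?_ ?_ ?_
    · exact dvdn 2 (by rw [hIa₆]; exact_mod_cast ha₆)
    · exact dvdn 3 (by rw [hIb₈]; exact_mod_cast hb₈)
    · intro h3
      exact not_pow_succ_dvd_of_valued_eq v (n := k) (by rw [hIb₆, hb₆])
        ((pow_dvd_pow ϖ (by omega : k + 1 ≤ 3)).trans h3)
  have hrel : X = (D.map (algebraMap ℚ (v.adicCompletion ℚ))) • W.baseChange (v.adicCompletion ℚ) := by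
    rw [hX, hM, WeierstrassCurve.baseChange, WeierstrassCurve.baseChange, map_variableChange]
  refine ⟨?_, ?_⟩
  · rw [W.kodairaSymbolAt_eq_kodairaSymbolOfMinimal_of_isMinimal v X _ hrel X.isUnit_Δ.ne_zero, ← hI,
      hK]
  · rw [W.ordMinimalDiscriminant_eq_of_isMinimal v X _ hrel X.isUnit_Δ.ne_zero, ← hI, hordΔ]

end Engine

/-! ### The certificate -/

/-- A Tate certificate for Steps 1–5 at the prime `p` on an integer model: the change of variables
`(u, r, s, t) = (1, r, s, t)` to a Step-2 normalised model, `n = v_p(Δ)`, the exit step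
(`2 ↦ II`, `3 ↦ III`, `4 ↦ IV`) and the exact exponent `k` of `b₈` (exit `3`) / `b₆` (exit `4`).
[cite: Silverman1994, IV.9.4 Steps 1–5] -/
structure Step2Cert where
  /-- the prime -/
  p : ℕ
  /-- translation `x = x' + r` -/
  r : ℤ
  /-- `y = y' + s x' + t` -/
  s : ℤ
  /-- `y = y' + s x' + t` -/
  t : ℤ
  /-- `n = v_p(Δ)` -/
  n : ℕ
  /-- exit step: `2` (type `II`), `3` (`III`), `4` (`IV`) -/
  exit : ℕ
  /-- `v_p(b₈)` (exit `3`) resp. `v_p(b₆)` (exit `4`) of the normalised model -/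
  k : ℕ
  deriving Repr, DecidableEq, Inhabited

namespace Step2Cert

variable (c : Step2Cert) (W : WeierstrassCurve ℤ)

/-- The translated integer model `(1, r, s, t) • W` (Silverman *AEC* III.1, Table 3.1 with `u = 1`),
spelled out for kernel evaluation. [cite: SilvermanAEC2009, III.1 Table 3.1] -/
def model : WeierstrassCurve ℤ where
  a₁ := W.a₁ + 2 * c.s
  a₂ := W.a₂ - c.s * W.a₁ + 3 * c.r - c.s ^ 2
  a₃ := W.a₃ + c.r * W.a₁ + 2 * c.t
  a₄ := W.a₄ - c.s * W.a₃ + 2 * c.r * W.a₂ - (c.t + c.r * c.s) * W.a₁ + 3 * c.r ^ 2 - 2 * c.s * c.t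
  a₆ := W.a₆ + c.r * W.a₄ + c.r ^ 2 * W.a₂ + c.r ^ 3 - c.t * W.a₃ - c.t ^ 2 - c.r * c.t * W.a₁

/-- `model` is Mathlib's change of variables by `⟨1, r, s, t⟩`. [cite: SilvermanAEC2009, III.1 Table 3.1] -/
theorem model_eq : c.model W = (⟨1, c.r, c.s, c.t⟩ : VariableChange ℤ) • W := by
  ext <;> simp [model, variableChange_a₁, variableChange_a₂, variableChange_a₃, variableChange_a₄,
    variableChange_a₆]

/-- `pᵉ ∣ x`, as a Boolean. [folklore] -/
def pdvd (p e : ℕ) (x : ℤ) : Bool := decide (((p : ℤ) ^ e) ∣ x)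

/-- `pᵉ ∥ x`, as a Boolean. [folklore] -/
def pexact (p e : ℕ) (x : ℤ) : Bool := pdvd p e x && !pdvd p (e + 1) x

/-- The Kodaira type certified by the exit step. [cite: Silverman1994, IV.9.4 Steps 3–5] -/
def type : KodairaSymbol :=
  if c.exit = 2 then .II else if c.exit = 3 then .III else .IV

/-- The certified conductor exponent `n + 1 - m` (Ogg's formula). [cite: Silverman1994, IV.11.1] -/
def f : ℕ := c.n + 1 - c.type.numComponents

/-- The kernel-decidable check of a Step-2 certificate: Step-2 normalisation (`p ∣ a₃, a₄, a₆, b₂`),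
`pⁿ ∥ Δ` with `1 ≤ n < 12`, and the exit test of Step 3, 4 or 5.
[cite: Silverman1994, IV.9.4 Steps 1–5] -/
def check : Bool :=
  let M := c.model W
  pdvd c.p 1 M.a₃ && pdvd c.p 1 M.a₄ && pdvd c.p 1 M.a₆ && pdvd c.p 1 M.b₂ &&
  decide (1 ≤ c.n) && decide (c.n < 12) && pexact c.p c.n M.Δ &&
  ((c.exit == 2 && pexact c.p 1 M.a₆) ||
    (c.exit == 3 && pdvd c.p 2 M.a₆ && decide (c.k < 3) && pexact c.p c.k M.b₈) ||
    (c.exit == 4 && pdvd c.p 2 M.a₆ && pdvd c.p 3 M.b₈ && decide (c.k < 3) && pexact c.p c.k M.b₆))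

variable {c W}

/-- `pdvd` decides `pᵉ ∣ x`. [folklore] -/
theorem pdvd_iff {p e : ℕ} {x : ℤ} : pdvd p e x = true ↔ (p : ℤ) ^ e ∣ x := by
  simp [pdvd]

/-- `pexact` decides `pᵉ ∥ x` (`pᵉ ∣ x` and `pᵉ⁺¹ ∤ x`). [folklore] -/
theorem pexact_iff {p e : ℕ} {x : ℤ} :
    pexact p e x = true ↔ (p : ℤ) ^ e ∣ x ∧ ¬ (p : ℤ) ^ (e + 1) ∣ x := by
  simp [pexact, pdvd]

/-- Coefficients and `b`-, `Δ`-quantities of the base change of an integer model. [folklore] -/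
theorem baseChange_eqs (W : WeierstrassCurve ℤ) :
    (W.baseChange ℚ).a₁ = (W.a₁ : ℚ) ∧ (W.baseChange ℚ).a₂ = (W.a₂ : ℚ) ∧
    (W.baseChange ℚ).a₃ = (W.a₃ : ℚ) ∧ (W.baseChange ℚ).a₄ = (W.a₄ : ℚ) ∧
    (W.baseChange ℚ).a₆ = (W.a₆ : ℚ) ∧ (W.baseChange ℚ).b₂ = (W.b₂ : ℚ) ∧
    (W.baseChange ℚ).b₆ = (W.b₆ : ℚ) ∧ (W.baseChange ℚ).b₈ = (W.b₈ : ℚ) ∧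
    (W.baseChange ℚ).Δ = (W.Δ : ℚ) := by
  refine ⟨?_, ?_, ?_, ?_, ?_, ?_, ?_, ?_, ?_⟩ <;>
    simp [WeierstrassCurve.baseChange, map_b₂, map_b₆, map_b₈, map_Δ]

/-- **Soundness of the Step-2 certificate**: if `c.check W₀` holds then at the place `v` of `𝓞 ℚ`
above `c.p` the curve `W₀ ⊗ ℚ` has Kodaira type `c.type` and `ord_v Δ_min = c.n` — NO named fact.
[cite: Silverman1994, IV.9.4 Steps 1–5] [cite: SilvermanAEC2009, VII.1 Remark 1.1] -/
theorem sound {W₀ : WeierstrassCurve ℤ} {c : Step2Cert} (v : HeightOneSpectrum (𝓞 ℚ))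
    (hv : natGenerator v = c.p) (hc : c.check W₀ = true) :
    (W₀.baseChange ℚ).kodairaSymbolAt v = c.type ∧ (W₀.baseChange ℚ).ordMinimalDiscriminant v = c.n := by
  simp only [check, Bool.and_eq_true, Bool.or_eq_true, beq_iff_eq, decide_eq_true_eq, pdvd_iff,
    pexact_iff] at hc
  obtain ⟨⟨⟨⟨⟨⟨⟨h3, h4⟩, h6⟩, hb2⟩, hn1⟩, hn⟩, ⟨hΔ, hΔ'⟩⟩, hexit⟩ := hc
  set M := (c.model W₀).baseChange ℚ with hMdef
  obtain ⟨e₁, e₂, e₃, e₄, e₆, eb₂, eb₆, eb₈, eΔ⟩ := baseChange_eqs (c.model W₀)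
  have hΔW : (c.model W₀).Δ = W₀.Δ := by
    rw [model_eq, variableChange_Δ]; simp
  have hΔ0 : (W₀.baseChange ℚ).Δ ≠ 0 := by
    rw [(baseChange_eqs W₀).2.2.2.2.2.2.2.2, Int.cast_ne_zero]
    rintro h0; rw [hΔW, h0] at hΔ'; exact hΔ' (dvd_zero _)
  haveI : (W₀.baseChange ℚ).IsElliptic := ⟨hΔ0.isUnit⟩
  have hM : M = ((⟨1, c.r, c.s, c.t⟩ : VariableChange ℤ).map (algebraMap ℤ ℚ)) • W₀.baseChange ℚ := by
    rw [hMdef, model_eq, WeierstrassCurve.baseChange, WeierstrassCurve.baseChange, map_variableChange]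
  refine kodairaSymbolAt_and_ordMinimalDiscriminant_of_step2_exits v (W₀.baseChange ℚ) M _ hM
    (by rw [e₁]; exact WeierstrassCurve.Rat.valuation_intCast_le_one v _)
    (by rw [e₂]; exact WeierstrassCurve.Rat.valuation_intCast_le_one v _)
    (by rw [e₃]; exact valuation_le_of_pow_dvd v hv h3)
    (by rw [e₄]; exact valuation_le_of_pow_dvd v hv h4)
    (by rw [e₆]; exact valuation_le_of_pow_dvd v hv h6)
    (by rw [eb₂]; exact valuation_le_of_pow_dvd v hv hb2) hn1 hn
    (by rw [eΔ]; exact valuation_eq_of_pow_dvd_of_not v hv hΔ hΔ') ?_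
  rcases hexit with (⟨h2, ha, ha'⟩ | ⟨⟨⟨h3x, ha⟩, hk⟩, hb, hb'⟩) | ⟨⟨⟨⟨h4x, ha⟩, hb8⟩, hk⟩, hb, hb'⟩
  · refine Or.inl ⟨?_, by simp [type, h2]⟩
    rw [e₆]; exact_mod_cast valuation_eq_of_pow_dvd_of_not v hv ha ha'
  · refine Or.inr (Or.inl ⟨?_, ⟨c.k, hk, ?_⟩, by simp [type, h3x]⟩)
    · rw [e₆]; exact_mod_cast valuation_le_of_pow_dvd v hv ha
    · rw [eb₈]; exact valuation_eq_of_pow_dvd_of_not v hv hb hb'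
  · refine Or.inr (Or.inr ⟨?_, ?_, ⟨c.k, hk, ?_⟩, by simp [type, h4x]⟩)
    · rw [e₆]; exact_mod_cast valuation_le_of_pow_dvd v hv ha
    · rw [eb₈]; exact_mod_cast valuation_le_of_pow_dvd v hv hb8
    · rw [eb₆]; exact valuation_eq_of_pow_dvd_of_not v hv hb hb'

/-- **The conductor exponent from a Step-2 certificate** at a place of `𝓞 ℚ`: Ogg's formula is the
definition of `conductorExponent`, so `f_v = n + 1 - m(type)`. [cite: Silverman1994, IV.11.1] -/
theorem conductorExponent_eq {W₀ : WeierstrassCurve ℤ} {c : Step2Cert} (v : HeightOneSpectrum (𝓞 ℚ))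
    (hv : natGenerator v = c.p) (hc : c.check W₀ = true) :
    (W₀.baseChange ℚ).conductorExponent v = c.f := by
  obtain ⟨hK, hn⟩ := sound v hv hc
  unfold WeierstrassCurve.conductorExponent WeierstrassCurve.numComponentsAt Step2Cert.f
  rw [hK, hn]

/-- The check implies `Δ ≠ 0` over `ℚ`. [folklore] -/
theorem isElliptic_of_step2Check {W₀ : WeierstrassCurve ℤ} {c : Step2Cert} (hc : c.check W₀ = true) :
    (W₀.baseChange ℚ).IsElliptic := by
  simp only [check, Bool.and_eq_true, Bool.or_eq_true, beq_iff_eq, decide_eq_true_eq, pdvd_iff,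
    pexact_iff] at hc
  obtain ⟨⟨-, ⟨-, hΔ'⟩⟩, -⟩ := hc
  have hΔW : (c.model W₀).Δ = W₀.Δ := by
    rw [model_eq, variableChange_Δ]; simp
  refine ⟨(show (W₀.baseChange ℚ).Δ ≠ 0 from ?_).isUnit⟩
  rw [(baseChange_eqs W₀).2.2.2.2.2.2.2.2, Int.cast_ne_zero]
  rintro h0; rw [hΔW, h0] at hΔ'; exact hΔ' (dvd_zero _)

/-- **The conductor exponent from a Step-2 certificate at a place of `ℤ`** (the census curves'
`conductorNorm ℤ` lives over `ℤ`): transfer along `conductorExponent_eq_of_primesEquiv_eq`.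
[cite: Silverman1994, IV.11.1] -/
theorem conductorExponent_int_eq {W₀ : WeierstrassCurve ℤ} {c : Step2Cert} (v : HeightOneSpectrum ℤ)
    (hv : natGenerator v = c.p) (hc : c.check W₀ = true) :
    (W₀.baseChange ℚ).conductorExponent v = c.f := by
  haveI := isElliptic_of_step2Check hc
  set v' : HeightOneSpectrum (𝓞 ℚ) := (primesEquiv (R := 𝓞 ℚ)).symm (primesEquiv v) with hv'def
  have hvv' : (primesEquiv v : Nat.Primes) = primesEquiv v' := by
    rw [hv'def, Equiv.apply_symm_apply]
  have hv' : natGenerator v' = c.p := by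
    have h1 : ((primesEquiv v' : Nat.Primes) : ℕ) = natGenerator v' := rfl
    have h2 : ((primesEquiv v : Nat.Primes) : ℕ) = natGenerator v := rfl
    rw [← h1, ← hvv', h2, hv]
  rw [conductorExponent_eq_of_primesEquiv_eq v v' _ hvv']
  exact conductorExponent_eq v' hv' hc

end Step2Cert

/-! ### Self-tests on rank-3 census curves (engine 1 = own Tate Steps 1–5, engine 2 = PARI) -/

/-- `26284a1 = [0,1,0,-9,16]` (`N = 2²·6571`): type `IV` at `2`, `v₂(Δ) = 4`, `f₂ = 2` — kernel check
of the certificate `(r,s,t) = (1,0,1)`. [cite: CremonaAlgorithms1997, Tables] -/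
theorem check_26284a1 : Step2Cert.check ⟨2, 1, 0, 1, 4, 4, 2⟩ ⟨0, 1, 0, -9, 16⟩ = true := by
  decide +kernel

/-- **`f₂(26284a1) = 2`, hypothesis-free** (type `IV` at `2`). [cite: CremonaAlgorithms1997, Tables] -/
theorem conductorExponent_two_26284a1 (v : HeightOneSpectrum ℤ) (hv : natGenerator v = 2) :
    ((⟨0, 1, 0, -9, 16⟩ : WeierstrassCurve ℤ).baseChange ℚ).conductorExponent v = 2 :=
  Step2Cert.conductorExponent_int_eq (c := ⟨2, 1, 0, 1, 4, 4, 2⟩) v hv check_26284a1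

/-- **`f₂(55064b1) = 3`** (`[0,1,0,-19,30]`, `N = 2³·6883`, type `III` at `2`, `v₂(Δ) = 4`,
`v₂(b₈) = 2`), hypothesis-free. [cite: CremonaAlgorithms1997, Tables] -/
theorem conductorExponent_two_55064b1 (v : HeightOneSpectrum ℤ) (hv : natGenerator v = 2) :
    ((⟨0, 1, 0, -19, 30⟩ : WeierstrassCurve ℤ).baseChange ℚ).conductorExponent v = 3 :=
  Step2Cert.conductorExponent_int_eq (c := ⟨2, 1, 0, 1, 4, 3, 2⟩) v hv (by decide +kernel)

/-- **`f₂(269936a1) = 4`** (`[0,-1,0,-234,1459]`, `N = 2⁴·16871`, type `II` at `2`, `v₂(Δ) = 4`),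
hypothesis-free. [cite: CremonaAlgorithms1997, Tables] -/
theorem conductorExponent_two_269936a1 (v : HeightOneSpectrum ℤ) (hv : natGenerator v = 2) :
    ((⟨0, -1, 0, -234, 1459⟩ : WeierstrassCurve ℤ).baseChange ℚ).conductorExponent v = 4 :=
  Step2Cert.conductorExponent_int_eq (c := ⟨2, 0, 0, 1, 4, 2, 1⟩) v hv (by decide +kernel)

/-- **`f₃(38601a1) = 2`** (`[0,0,1,3,16]`, `N = 3²·4289`, type `III` at `3`, `v₃(Δ) = 3`,
`v₃(b₈) = 2`), hypothesis-free. [cite: CremonaAlgorithms1997, Tables] -/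
theorem conductorExponent_three_38601a1 (v : HeightOneSpectrum ℤ) (hv : natGenerator v = 3) :
    ((⟨0, 0, 1, 3, 16⟩ : WeierstrassCurve ℤ).baseChange ℚ).conductorExponent v = 2 :=
  Step2Cert.conductorExponent_int_eq (c := ⟨3, 1, 0, 1, 3, 3, 2⟩) v hv (by decide +kernel)

end Summit.BirchSwinnertonDyer.BirchSwinnertonDyer.Rank2Observatory.Tate
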